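import Mathlib
import HarnessLib
import Literature.MathematicalPhysics.StatisticalMechanics.TorusFRDFourier
import Literature.MathematicalPhysics.StatisticalMechanics.GaussianFormChange
import Literature.Probability.Distributions.GaussianQuadraticTilt

/-!
# Translation-invariant operators on the discrete torus are diagonal in Fourier space: the
# DETERMINANT of `∇*A∇ + c𝟙𝟙ᵀ` on `(ℤ/M)^d` and the Gaussian normalisation ratio `κ_{A,A'}`
# (Buchholz 2018, §2; [ABKM19] (4.7): `Z^{(q)}/Z^{(0)}` in closed form)

The characters `χ_κ(x) = Π_i e^{2πi κ_i x_i/M}` of `Λ = (ℤ/M)^d`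
(`Literature.Probability.LatticeModels.torusChar`) are joint eigenvectors of the forward/backward
differences, hence of the elliptic operator `∇*A∇` (matrix `GradientRG.ellMat A`, eigenvalue the symbol
`GradientFRD.symb A κ = Σ A_ij conj(q_i) q_j`, Buchholz (2.18)) and of the zero-mode matrix `c𝟙𝟙ᵀ`
(`constMat c`, eigenvalue `c|Λ|` on `χ_0` and `0` otherwise).  Consequently

* `det_eq_prod_of_mulVec_torusChar` — a complex matrix having every `χ_κ` as an eigenvector with
  eigenvalue `m κ` has determinant `Π_κ m κ` (character orthogonality `ΦᴴΦ = |Λ|·1`);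
* **`det_ellMat_add_constMat`** — `det(∇*A∇ + c𝟙𝟙ᵀ) = c|Λ| · Π_{κ ≠ 0} symbR A κ` for symmetric `A`;
* **`log_formChangeConst_eq`** — the normalisation ratio of [ABKM19] (4.7),
  `κ_{A,A'} = Z_{A'}/Z_A` (`GradientRG.formChangeConst`, `Z_A = ∫ e^{−½(φ,(∇*A∇ + 𝟙𝟙ᵀ/|Λ|²)φ)}`), satisfies
  `log κ_{A,A'} = ½ Σ_{κ ≠ 0} (log symbR A κ − log symbR A' κ)` for elliptic `A, A'` — a sum of
  `|Λ| − 1` single-mode terms, the form in which its dependence on the coefficient matrix is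
  controlled uniformly in the volume (Theorem 2.2 of [ABKM19], smoothness of `q ↦ 𝒲_N`).

Everything is proved; no named fact.

## References
* S. Buchholz, *Finite range decomposition for Gaussian measures with improved regularity*,
  J. Funct. Anal. 275 (2018), §2 (2.14)–(2.18) ("translation invariant operators are diagonal in
  Fourier space") [Buchholz2016].
* S. Adams, S. Buchholz, R. Kotecký, S. Müller, arXiv:1910.13564, Ch. 4.2 (4.5)–(4.8)
  [AdamsBuchholzKoteckyMuller2019].
-/

noncomputable section

namespace Literature.MathematicalPhysics.StatisticalMechanics.GradientRG

open scoped BigOperators ComplexConjugate Matrix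
open Finset Complex Matrix
open Literature.Probability.LatticeModels (torusChar torusChar_add_right torusChar_sub_right
  torusChar_sub_left torusChar_zero_left sum_torusChar_right)
open Literature.MathematicalPhysics.StatisticalMechanics.GradientFRD (qmode symb symbR symb_eq_symbR
  symb_zero symbR_pos IsElliptic)
open Literature.MathematicalPhysics.QuantumFieldTheory.GaussianToolkit (gaussZ)

variable {d M : ℕ} [NeZero M]

/-! ## §1 The characters are eigenvectors of `∇_j`, `∇_i^*`, `∇*A∇`, `c𝟙𝟙ᵀ` -/

/-- `∇_j χ_κ = q_j(κ) χ_κ` (`q_j(κ) = χ_κ(e_j) − 1`). [cite: Buchholz2016, §2 (2.18)] -/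
theorem fwdMat_map_mulVec_torusChar (j : Fin d) (κ : Fin d → ZMod M) :
    (fwdMat (M := M) j).map ((↑) : ℝ → ℂ) *ᵥ (fun x => torusChar κ x)
      = qmode κ j • (fun x => torusChar κ x) := by
  funext s
  simp only [Matrix.mulVec, dotProduct, Matrix.map_apply, fwdMat, Pi.smul_apply, smul_eq_mul,
    Complex.ofReal_sub, apply_ite ((↑) : ℝ → ℂ), Complex.ofReal_one, Complex.ofReal_zero, sub_mul,
    ite_mul, one_mul, zero_mul, Finset.sum_sub_distrib, Finset.sum_ite_eq', Finset.mem_univ, if_true]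
  rw [torusChar_add_right, qmode]
  ring

/-- `∇_i^* χ_κ = conj(q_i(κ)) χ_κ`. [cite: Buchholz2016, §2 (2.18)] -/
theorem fwdMat_transpose_map_mulVec_torusChar (i : Fin d) (κ : Fin d → ZMod M) :
    ((fwdMat (M := M) i)ᵀ).map ((↑) : ℝ → ℂ) *ᵥ (fun x => torusChar κ x)
      = conj (qmode κ i) • (fun x => torusChar κ x) := by
  funext s
  simp only [Matrix.mulVec, dotProduct, Matrix.map_apply, Matrix.transpose_apply, fwdMat, Pi.smul_apply,
    smul_eq_mul, Complex.ofReal_sub, apply_ite ((↑) : ℝ → ℂ), Complex.ofReal_one, Complex.ofReal_zero,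
    sub_mul, ite_mul, one_mul, zero_mul, Finset.sum_sub_distrib]
  have h1 : ∑ t : Fin d → ZMod M, (if s = t + Pi.single i 1 then torusChar κ t else 0)
      = torusChar κ (s - Pi.single i 1) := by
    have : ∀ t : Fin d → ZMod M, (s = t + Pi.single i 1) = (t = s - Pi.single i 1) := fun t =>
      propext ⟨fun h => by rw [h, add_sub_cancel_right], fun h => by rw [h, sub_add_cancel]⟩
    simp_rw [this]
    rw [Finset.sum_ite_eq' Finset.univ (s - Pi.single i 1)]
    simp
  have h2 : ∑ t : Fin d → ZMod M, (if s = t then torusChar κ t else 0) = torusChar κ s := by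
    rw [Finset.sum_ite_eq Finset.univ s]; simp
  rw [h1, h2, torusChar_sub_right, qmode, map_sub, map_one]
  ring

omit [NeZero M] in
/-- Scalar multiples commute with the complexification of a real matrix. [folklore] -/
private theorem map_smul_ofReal (a : ℝ) (T : Matrix (Fin d → ZMod M) (Fin d → ZMod M) ℝ) :
    (a • T).map ((↑) : ℝ → ℂ) = (a : ℂ) • T.map ((↑) : ℝ → ℂ) := by
  ext s t
  simp

/-- **`∇*A∇ χ_κ = â(κ) χ_κ`** with `â = symb A` (Buchholz (2.18)). [cite: Buchholz2016, §2 (2.18)] -/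
theorem ellMat_map_mulVec_torusChar (A : Matrix (Fin d) (Fin d) ℝ) (κ : Fin d → ZMod M) :
    (ellMat (M := M) A).map ((↑) : ℝ → ℂ) *ᵥ (fun x => torusChar κ x)
      = symb A κ • (fun x => torusChar κ x) := by
  have hmap : (ellMat (M := M) A).map ((↑) : ℝ → ℂ)
      = ∑ i : Fin d, ∑ j : Fin d, (A i j : ℂ) •
          (((fwdMat (M := M) i)ᵀ).map ((↑) : ℝ → ℂ) * (fwdMat (M := M) j).map ((↑) : ℝ → ℂ)) := by
    ext s t
    simp only [ellMat, Matrix.map_apply, Matrix.sum_apply, Matrix.smul_apply, Matrix.mul_apply,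
      Matrix.transpose_apply, smul_eq_mul]
    push_cast
    rfl
  rw [hmap, Matrix.sum_mulVec]
  have hterm : ∀ i j : Fin d,
      ((A i j : ℂ) • (((fwdMat (M := M) i)ᵀ).map ((↑) : ℝ → ℂ) * (fwdMat (M := M) j).map ((↑) : ℝ → ℂ)))
        *ᵥ (fun x => torusChar κ x)
        = ((A i j : ℂ) * conj (qmode κ i) * qmode κ j) • (fun x => torusChar κ x) := by
    intro i j
    rw [Matrix.smul_mulVec, ← Matrix.mulVec_mulVec, fwdMat_map_mulVec_torusChar, Matrix.mulVec_smul,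
      fwdMat_transpose_map_mulVec_torusChar, smul_smul, smul_smul]
    congr 1
    ring
  funext x
  simp only [Finset.sum_apply, Matrix.sum_mulVec, hterm, Pi.smul_apply, smul_eq_mul, symb, Finset.sum_mul]

/-- **`c𝟙𝟙ᵀ χ_κ = c|Λ| δ_{κ,0} χ_κ`** (the zero-mode matrix sees only the constant character).
[cite: AdamsBuchholzKoteckyMuller2019, Lemma 6.3] -/
theorem constMat_map_mulVec_torusChar (c : ℝ) (κ : Fin d → ZMod M) :
    (constMat (Λ := Fin d → ZMod M) c).map ((↑) : ℝ → ℂ) *ᵥ (fun x => torusChar κ x)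
      = (if κ = 0 then (c : ℂ) * (M : ℂ) ^ d else 0) • (fun x => torusChar κ x) := by
  funext s
  simp only [Matrix.mulVec, dotProduct, Matrix.map_apply, constMat, Matrix.of_apply, Pi.smul_apply,
    smul_eq_mul]
  rw [← Finset.mul_sum, sum_torusChar_right]
  by_cases hκ : κ = 0
  · subst hκ; simp [torusChar_zero_left]
  · simp [hκ]

/-! ## §2 The character matrix and the determinant of a Fourier multiplier -/

/-- **Character orthogonality as a matrix identity** for the character matrix `Φ(x, κ) = χ_κ(x)`
(columns = characters): `ΦᴴΦ = |Λ|·1`, `|Λ| = M^d`. [cite: Buchholz2016, §2 (2.15)] -/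
theorem conjTranspose_charMat_mul_charMat :
    (Matrix.of fun (x κ : Fin d → ZMod M) => torusChar κ x)ᴴ * (Matrix.of fun (x κ : Fin d → ZMod M) => torusChar κ x)
      = ((M : ℂ) ^ d) • (1 : Matrix (Fin d → ZMod M) (Fin d → ZMod M) ℂ) := by
  ext κ κ'
  rw [Matrix.mul_apply]
  simp only [Matrix.conjTranspose_apply, Matrix.of_apply, Matrix.smul_apply, Matrix.one_apply,
    smul_eq_mul, mul_ite, mul_one, mul_zero]
  have h : ∀ x : Fin d → ZMod M, star (torusChar κ x) * torusChar κ' x = torusChar (κ' - κ) x := by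
    intro x
    rw [torusChar_sub_left, Complex.star_def, mul_comm]
  simp_rw [h]
  rw [sum_torusChar_right]
  by_cases hκ : κ = κ'
  · subst hκ; simp
  · have : ¬ (κ' - κ = 0) := fun h0 => hκ (sub_eq_zero.1 h0).symm
    simp [hκ, this]

/-- The character matrix is invertible: `det Φ ≠ 0`. [cite: Buchholz2016, §2 (2.15)] -/
theorem det_charMat_ne_zero : (Matrix.of fun (x κ : Fin d → ZMod M) => torusChar κ x).det ≠ 0 := by
  intro h0
  have h := congrArg Matrix.det (conjTranspose_charMat_mul_charMat (d := d) (M := M))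
  rw [Matrix.det_mul, Matrix.det_conjTranspose, h0, mul_zero, Matrix.det_smul, Matrix.det_one, mul_one] at h
  have hM : ((M : ℂ) ^ d) ≠ 0 := pow_ne_zero _ (Nat.cast_ne_zero.2 (NeZero.ne M))
  exact pow_ne_zero _ hM h.symm

/-- **The determinant of a Fourier multiplier**: if every character `χ_κ` is an eigenvector of the
complex matrix `T` with eigenvalue `m κ`, then `det T = Π_κ m κ`. [cite: Buchholz2016, §2 (2.17)–(2.18)] -/
theorem det_eq_prod_of_mulVec_torusChar {T : Matrix (Fin d → ZMod M) (Fin d → ZMod M) ℂ}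
    {m : (Fin d → ZMod M) → ℂ} (h : ∀ κ, T *ᵥ (fun x => torusChar κ x) = m κ • (fun x => torusChar κ x)) :
    T.det = ∏ κ, m κ := by
  have hmul : T * (Matrix.of fun (x κ : Fin d → ZMod M) => torusChar κ x)
      = (Matrix.of fun (x κ : Fin d → ZMod M) => torusChar κ x) * Matrix.diagonal m := by
    ext x κ
    rw [Matrix.mul_diagonal, Matrix.mul_apply]
    have hx := congrFun (h κ) x
    simp only [Matrix.mulVec, dotProduct, Pi.smul_apply, smul_eq_mul] at hx
    simp only [Matrix.of_apply]
    rw [hx, mul_comm]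
  have hdet := congrArg Matrix.det hmul
  rw [Matrix.det_mul, Matrix.det_mul, Matrix.det_diagonal, mul_comm] at hdet
  exact mul_left_cancel₀ det_charMat_ne_zero hdet

/-! ## §3 The determinant of `∇*A∇ + c𝟙𝟙ᵀ` -/

/-- **`det(∇*A∇ + c𝟙𝟙ᵀ) = Π_κ (â(κ) + c|Λ|δ_{κ,0})`** (complex form, any real `A`).
[cite: Buchholz2016, §2 (2.18)] -/
theorem det_ellMat_add_constMat_map (A : Matrix (Fin d) (Fin d) ℝ) (c : ℝ) :
    ((ellMat (M := M) A + constMat c).map ((↑) : ℝ → ℂ)).det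
      = ∏ κ : Fin d → ZMod M, (symb A κ + if κ = 0 then (c : ℂ) * (M : ℂ) ^ d else 0) := by
  refine det_eq_prod_of_mulVec_torusChar fun κ => ?_
  rw [Matrix.map_add _ Complex.ofReal_add, Matrix.add_mulVec, ellMat_map_mulVec_torusChar,
    constMat_map_mulVec_torusChar, ← add_smul]

/-- **`det(∇*A∇ + c𝟙𝟙ᵀ) = c·|Λ|·Π_{κ ≠ 0} symbR A κ`** for symmetric `A` (the zero mode carries
`c|Λ|`, every other mode the real symbol `symbR A κ`; `â(0) = 0`). [cite: Buchholz2016, §2 (2.18)] -/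
theorem det_ellMat_add_constMat {A : Matrix (Fin d) (Fin d) ℝ} (hA : A.IsSymm) (c : ℝ) :
    (ellMat (M := M) A + constMat c).det
      = c * (M : ℝ) ^ d * ∏ κ ∈ (Finset.univ : Finset (Fin d → ZMod M)).erase 0, symbR A κ := by
  apply Complex.ofReal_injective
  have h := det_ellMat_add_constMat_map (M := M) A c
  rw [Literature.Probability.Distributions.det_map_ofReal] at h
  rw [h, ← Finset.mul_prod_erase Finset.univ _ (Finset.mem_univ (0 : Fin d → ZMod M)), symb_zero, zero_add,
    if_pos rfl]
  push_cast
  congr 1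
  refine Finset.prod_congr rfl fun κ hκ => ?_
  rw [if_neg (Finset.ne_of_mem_erase hκ), add_zero, symb_eq_symbR hA]

/-- For elliptic `A` (`ω₀ > 0`) and `c > 0` the determinant is positive. [cite: Buchholz2016, §2 (2.18)–(2.20)] -/
theorem det_ellMat_add_constMat_pos {ω₀ Ω₀ : ℝ} {A : Matrix (Fin d) (Fin d) ℝ} (hA : IsElliptic ω₀ Ω₀ A)
    (hω : 0 < ω₀) {c : ℝ} (hc : 0 < c) :
    0 < (ellMat (M := M) A + constMat c).det := by
  rw [det_ellMat_add_constMat hA.1 c]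
  have hM : (0 : ℝ) < (M : ℝ) ^ d := pow_pos (by exact_mod_cast Nat.pos_of_ne_zero (NeZero.ne M)) d
  refine mul_pos (mul_pos hc hM) (Finset.prod_pos fun κ hκ => symbR_pos hA hω (Finset.ne_of_mem_erase hκ))

/-- `log det(∇*A∇ + c𝟙𝟙ᵀ) = log(c|Λ|) + Σ_{κ ≠ 0} log symbR A κ` for elliptic `A`, `c > 0`.
[cite: Buchholz2016, §2 (2.18)] -/
theorem log_det_ellMat_add_constMat {ω₀ Ω₀ : ℝ} {A : Matrix (Fin d) (Fin d) ℝ} (hA : IsElliptic ω₀ Ω₀ A)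
    (hω : 0 < ω₀) {c : ℝ} (hc : 0 < c) :
    Real.log (ellMat (M := M) A + constMat c).det
      = Real.log (c * (M : ℝ) ^ d) + ∑ κ ∈ (Finset.univ : Finset (Fin d → ZMod M)).erase 0, Real.log (symbR A κ) := by
  rw [det_ellMat_add_constMat hA.1 c, Real.log_mul, Real.log_prod]
  · exact fun κ hκ => (symbR_pos hA hω (Finset.ne_of_mem_erase hκ)).ne'
  · have hM : (0 : ℝ) < (M : ℝ) ^ d := pow_pos (by exact_mod_cast Nat.pos_of_ne_zero (NeZero.ne M)) d
    exact (mul_pos hc hM).ne'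
  · exact (Finset.prod_pos fun κ hκ => symbR_pos hA hω (Finset.ne_of_mem_erase hκ)).ne'

/-! ## §4 The normalisation ratio `κ_{A,A'}` in closed form -/

/-- **`log κ_{A,A'} = ½ Σ_{κ ≠ 0} (log symbR A κ − log symbR A' κ)`** ([ABKM19] (4.7): the Gaussian
normalisation ratio `Z^{(q)}/Z^{(0)}`-type factor of the change of the quadratic form is a product over the
non-zero Fourier modes; the zero-mode regularisation `𝟙𝟙ᵀ/|Λ|²` cancels).  Hypotheses: `A, A'` elliptic
with positive lower constants, and the two regularised precisions positive definite (so that the Gaussian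
normalisations are the finite numbers `√(2π)^{|Λ|}/√det`). [cite: AdamsBuchholzKoteckyMuller2019, Ch. 4.2 (4.7)] -/
theorem log_formChangeConst_eq {ω₀ Ω₀ ω₀' Ω₀' : ℝ} {A A' : Matrix (Fin d) (Fin d) ℝ}
    (hA : IsElliptic ω₀ Ω₀ A) (hω : 0 < ω₀) (hA' : IsElliptic ω₀' Ω₀' A') (hω' : 0 < ω₀')
    (hP : (ellMat (M := M) A + constMat (((Fintype.card (Fin d → ZMod M) : ℝ) ^ 2)⁻¹)).PosDef)
    (hP' : (ellMat (M := M) A' + constMat (((Fintype.card (Fin d → ZMod M) : ℝ) ^ 2)⁻¹)).PosDef) :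
    Real.log (formChangeConst (M := M) A A')
      = (1 / 2 : ℝ) * ∑ κ ∈ (Finset.univ : Finset (Fin d → ZMod M)).erase 0,
          (Real.log (symbR A κ) - Real.log (symbR A' κ)) := by
  set c : ℝ := ((Fintype.card (Fin d → ZMod M) : ℝ) ^ 2)⁻¹ with hc
  have hcpos : 0 < c := by
    rw [hc]; exact inv_pos.2 (pow_pos (by exact_mod_cast Fintype.card_pos) 2)
  set P := ellMat (M := M) A + constMat c with hPdef
  set P' := ellMat (M := M) A' + constMat c with hP'def
  have hdet : 0 < P.det := det_ellMat_add_constMat_pos hA hω hcpos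
  have hdet' : 0 < P'.det := det_ellMat_add_constMat_pos hA' hω' hcpos
  -- the Gaussian normalisations in closed form
  have hZ : (gaussZ P).toReal = Real.sqrt (2 * Real.pi) ^ Fintype.card (Fin d → ZMod M) / Real.sqrt P.det :=
    Literature.Probability.Distributions.gaussZ_toReal_eq hP
  have hZ' : (gaussZ P').toReal = Real.sqrt (2 * Real.pi) ^ Fintype.card (Fin d → ZMod M) / Real.sqrt P'.det :=
    Literature.Probability.Distributions.gaussZ_toReal_eq hP'
  have hK : formChangeConst (M := M) A A' = (gaussZ P').toReal / (gaussZ P).toReal := by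
    unfold formChangeConst
    rw [ENNReal.toReal_mul, ENNReal.toReal_inv, div_eq_mul_inv]
  have hS : 0 < Real.sqrt (2 * Real.pi) ^ Fintype.card (Fin d → ZMod M) :=
    pow_pos (Real.sqrt_pos.2 (by positivity)) _
  have hsq : 0 < Real.sqrt P.det := Real.sqrt_pos.2 hdet
  have hsq' : 0 < Real.sqrt P'.det := Real.sqrt_pos.2 hdet'
  have hK2 : formChangeConst (M := M) A A' = Real.sqrt P.det / Real.sqrt P'.det := by
    rw [hK, hZ, hZ']
    field_simp
  rw [hK2, Real.log_div hsq.ne' hsq'.ne', Real.log_sqrt hdet.le, Real.log_sqrt hdet'.le,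
    log_det_ellMat_add_constMat hA hω hcpos, log_det_ellMat_add_constMat hA' hω' hcpos, Finset.sum_sub_distrib]
  ring

end Literature.MathematicalPhysics.StatisticalMechanics.GradientRG

end
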